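import Summits.BirchSwinnertonDyer.BirchSwinnertonDyer.Theorems.AlignedTransportAtTwoMainConjectureOfRankZeroBSDAtTwoFineRoadCoinv
import Summits.BirchSwinnertonDyer.BirchSwinnertonDyer.Theorems.AlignedTransportAtTwoMainConjectureOfRankZeroBSDAtTwoSeed
import HarnessLib

/-!
# Route `AlignedTransportAtTwo`, crux C2 `MainConjectureOfRankZeroBSDAtTwo` (stmt-BirchSwinnertonDyer-22298):
# road (b″) at the crux level — C2 from PRINT + Lim 2017 at `2` + displayed Kato data over `ℚ(i)` with the
# `Δ`-descent maps + classical `μ = 0` of the seeds' cubic fields (NO construction target at `(2)`, NO odd branch)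

HONEST FRAMING (cell `bsd-f1-sign2`, lead prover seat `bsd-line-att-p2` gen 2; BSD is NOT proved by any of
this). THEOREMS ONLY; nothing asserted. Continuation of `…FineRoadCoinv` (the coinvariants-first bookkeeping
`ℓ(X_Δ) ≤ ℓ(R²/col P) + ℓ(R/(a+b)) + ℓ(Y_Δ)`). Here, at `p = 2` with the tree's objects over `ℚ`:

* `lengthAt_augIdealP_eq_zero_of_roadB2` — over `Λ₀ = ℤ_p⟦T⟧` at `(p)`: finite Coleman cokernel, `a + b ∉ (p)`
  and `ℓ_{(p)}(Y_Δ) = 0` give `ℓ_{(p)}(X_Δ) = 0`.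
* `selmerDual_mu_eq_zero_of_roadB2_two` — PER DATUM: `D` (dual of `Sel_{2^∞}(E/ℚ_∞)`), `Yd` (dual of
  `Sel₀(ℚ_∞, E[2^∞])`), statement (A) at `(E, 2)` OVER `ℚ` (`Sel₀[2]` finite), the crux's analytic `μ₂ = 0`
  (`red G ≠ 0` for the integral lift `G` of `L₂(f, α)`), and DISPLAYED data: `Λ₀`-modules `P, X', Y'` with a
  `Δ`-action (`= 𝐇¹_loc/𝐇¹_f`, `X(E/K_∞)`, `X₀(E/K_∞)` over `K_∞ = ℚ(ζ_{2^∞})`, `K = ℚ(i)`), the Poitou–Tate row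
  `P → X' → Y' → 0` ((14.9.3)/(17.13.1)), an injective `Δ`-equivariant Coleman map `col : P → Λ₀ × Λ₀ = Λ_G`
  with FINITE cokernel (Prop. 17.11), the images `(a,b)`, `(b,a)` of `z_{c,d}`, `c·z_{c,d}` (Thm. 12.6) with
  `a + b = χ₊(𝔏(z_{c,d})) = s·G`, `s ∉ (2)` (Thm. 16.6 and the `(c,d)`-factor), a descent map
  `X'_Δ → X(E/ℚ_∞)` with finite cokernel and a comparison `Y'_Δ → X₀(E/ℚ_∞)` with finite kernel
  (restriction–inflation along `ℚ_∞(i)/ℚ_∞`; finite when `Δ_E < 0` — for `Δ_E > 0` the two archimedean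
  `(Λ/2)`-terms of Greenberg's strict/relaxed phenomenon must first be cancelled, NOT done here)
  ⟹ `μ(X(E/ℚ_∞)) = 0`.
* `seedMuZeroAtTwo_of_fineRoadCoinv` / `mainConjectureOfRankZeroBSDAtTwo_of_fineRoadCoinv` — stub T and C2 BY
  NAME from PRINT {modularity, Lim 2017 Thm. 3.5 at `2`} + (K₂″) the displayed data for every seed and datum
  (printed statements at `2` awaiting typing and the `×2` audit of (17.13.1); plus the archimedean
  cancellation for `Δ_E > 0`) + (A₂) a `2`-power-index subfield of `ℚ(W[4])` with classical `μ = 0` for every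
  seed (the cubic field; Iwasawa's conjecture — OPEN for `S₃`-cubics, Fukuda/Iwasawa-1956 numeric doors).
  Compared with road (b): the construction target at `(2)` is gone; with (b′): the odd branch is gone.

References: K. Kato, Astérisque 295 (2004), §12.1, Thm. 12.6, (14.9.3), Thm. 16.6, Prop. 17.11, §17.13;
M. F. Lim, Asian J. Math. 21 (2017) Thm. 3.5; J. Coates, R. Sujatha, Math. Ann. 331 (2005) §3;
R. Greenberg, LNM 1716 (1999) §3, Conj. 1.11, Thm. 4.1.
-/

set_option linter.dupNamespace false
set_option autoImplicit false

noncomputable section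

open scoped Classical

open Literature.NumberTheory.EllipticCurves Literature.NumberTheory.EllipticCurves.Module

namespace Summit.BirchSwinnertonDyer.BirchSwinnertonDyer.Theorems.AlignedTransportAtTwoFineRoad

/-! ## §1 Over `Λ₀` at `(p)` -/

section AtP

variable (p : ℕ) [Fact p.Prime]
  {P X Y : Type*} [AddCommGroup P] [_root_.Module (IwasawaAlgebra p) P]
  [AddCommGroup X] [_root_.Module (IwasawaAlgebra p) X]
  [AddCommGroup Y] [_root_.Module (IwasawaAlgebra p) Y]

/-- For `h : M → N`: `ℓ_𝔭(M) ≤ ℓ_𝔭(ker h) + ℓ_𝔭(N)`. [folklore] -/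
theorem lengthAt_le_ker_add {R : Type*} [CommRing R] {M N : Type*} [AddCommGroup M] [_root_.Module R M]
    [AddCommGroup N] [_root_.Module R N] (h : M →ₗ[R] N) (𝔭 : PrimeSpectrum R) :
    lengthAt R M 𝔭 ≤ lengthAt R (LinearMap.ker h) 𝔭 + lengthAt R N 𝔭 :=
  lengthAt_le_add_of_exact (LinearMap.ker h).subtype h
    (by rw [LinearMap.exact_iff, Submodule.range_subtype]) 𝔭

/-- **Road (b″) at `(p)`.** In `lengthAt_coinv_le_of_roadB2` over `Λ₀ = ℤ_p⟦T⟧`: a FINITE Coleman cokernel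
(Prop. 17.11), the even branch value `a + b ∉ (p)` and `ℓ_{(p)}(Y_Δ) = 0` give `ℓ_{(p)}(X_Δ) = 0`.
[cite: Kato2004Asterisque, Prop. 17.11 (p. 277) and §17.13 (pp. 279–280)] -/
theorem lengthAt_augIdealP_eq_zero_of_roadB2 (toX : P →ₗ[IwasawaAlgebra p] X)
    (π : X →ₗ[IwasawaAlgebra p] Y) (hX : Function.Exact toX π) (hπ : Function.Surjective π)
    (cP : P →ₗ[IwasawaAlgebra p] P) (cX : X →ₗ[IwasawaAlgebra p] X) (cY : Y →ₗ[IwasawaAlgebra p] Y)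
    (hcX : toX ∘ₗ cP = cX ∘ₗ toX) (hcY : π ∘ₗ cX = cY ∘ₗ π)
    (col : P →ₗ[IwasawaAlgebra p] IwasawaAlgebra p × IwasawaAlgebra p) (hcol : Function.Injective col)
    (hccol : col ∘ₗ cP = (LinearEquiv.prodComm (IwasawaAlgebra p) (IwasawaAlgebra p) (IwasawaAlgebra p) :
      IwasawaAlgebra p × IwasawaAlgebra p →ₗ[IwasawaAlgebra p] IwasawaAlgebra p × IwasawaAlgebra p) ∘ₗ col)
    (hfin : Finite ((IwasawaAlgebra p × IwasawaAlgebra p) ⧸ LinearMap.range col))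
    {w₁ w₂ : P} (h₁ : toX w₁ = 0) (h₂ : toX w₂ = 0) {a b : IwasawaAlgebra p} (hw₁ : col w₁ = (a, b))
    (hw₂ : col w₂ = (b, a)) (hab : a + b ∉ IwasawaAlgebra.augIdealP p)
    (𝔭 : PrimeSpectrum (IwasawaAlgebra p)) (h𝔭 : 𝔭.asIdeal = IwasawaAlgebra.augIdealP p)
    (hY : lengthAt (IwasawaAlgebra p) (Y ⧸ LinearMap.range (cY - 1)) 𝔭 = 0) :
    lengthAt (IwasawaAlgebra p) (X ⧸ LinearMap.range (cX - 1)) 𝔭 = 0 := by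
  haveI := hfin
  have h := lengthAt_coinv_le_of_roadB2 toX π hX hπ cP cX cY hcX hcY col hcol hccol h₁ h₂ hw₁ hw₂ 𝔭
  have hc : lengthAt (IwasawaAlgebra p) ((IwasawaAlgebra p × IwasawaAlgebra p) ⧸ LinearMap.range col) 𝔭
      = 0 := lengthAt_augIdealP_eq_zero_of_finite p _ 𝔭 h𝔭
  have hq : lengthAt (IwasawaAlgebra p) (IwasawaAlgebra p ⧸ Ideal.span {a + b}) 𝔭 = 0 :=
    lengthAt_quotient_eq_zero_of_not_le (by rwa [Ideal.span_singleton_le_iff_mem, h𝔭])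
  rw [hc, hq, hY] at h
  simpa using h

end AtP

/-! ## §2 The per-datum statement at `2` over `ℚ(i)`, descended to `ℚ_∞` -/

section AtTwo

open WeierstrassCurve Summit.BirchSwinnertonDyer.Rank1Residual.X1.MuLambda

variable (W : WeierstrassCurve ℚ) {κ : ZpExtension ℚ 2} {γ : Field.absoluteGaloisGroup ℚ}

/-- **ROAD (b″), PER CYCLOTOMIC DATUM** (reading of every displayed hypothesis in the module docstring):
statement (A) at `(E, 2)` over `ℚ` (`hA`), the analytic `μ₂ = 0` of the EVEN branch (`hred`), Kato data over
`ℚ(ζ_{2^∞})` with `Δ`-action and finite Coleman cokernel, the even-branch value `a + b = s·G`, the descent map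
`fd` (finite cokernel) and the fine comparison `fy` (finite kernel) ⟹ `μ(X(E/ℚ_∞)) = 0`.
[cite: Kato2004Asterisque, §12.1, Thm. 12.6, Thm. 16.6, Prop. 17.11, §17.13 (pp. 219–280)]
[cite: CoatesSujatha2005, statement (A) (§3)] -/
theorem selmerDual_mu_eq_zero_of_roadB2_two (hγ : κ.IsTopGenerator γ) (D : W.SelmerDualData κ γ)
    (Yd : W.FineSelmerDualData κ γ) (hA : Set.Finite {s : W.fineSelmerInfty κ | 2 • s = 0})
    {G : IwasawaAlgebra 2} (hred : red G ≠ 0)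
    {P X' Y' : Type*} [AddCommGroup P] [_root_.Module (IwasawaAlgebra 2) P]
    [AddCommGroup X'] [_root_.Module (IwasawaAlgebra 2) X']
    [AddCommGroup Y'] [_root_.Module (IwasawaAlgebra 2) Y']
    (toX : P →ₗ[IwasawaAlgebra 2] X') (π : X' →ₗ[IwasawaAlgebra 2] Y') (hX : Function.Exact toX π)
    (hπ : Function.Surjective π) (cP : P →ₗ[IwasawaAlgebra 2] P) (cX : X' →ₗ[IwasawaAlgebra 2] X')
    (cY : Y' →ₗ[IwasawaAlgebra 2] Y') (hcX : toX ∘ₗ cP = cX ∘ₗ toX) (hcY : π ∘ₗ cX = cY ∘ₗ π)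
    (col : P →ₗ[IwasawaAlgebra 2] IwasawaAlgebra 2 × IwasawaAlgebra 2) (hcol : Function.Injective col)
    (hccol : col ∘ₗ cP = (LinearEquiv.prodComm (IwasawaAlgebra 2) (IwasawaAlgebra 2) (IwasawaAlgebra 2) :
      IwasawaAlgebra 2 × IwasawaAlgebra 2 →ₗ[IwasawaAlgebra 2] IwasawaAlgebra 2 × IwasawaAlgebra 2) ∘ₗ col)
    (hfin : Finite ((IwasawaAlgebra 2 × IwasawaAlgebra 2) ⧸ LinearMap.range col))
    {w₁ w₂ : P} (h₁ : toX w₁ = 0) (h₂ : toX w₂ = 0) {a b s : IwasawaAlgebra 2} (hw₁ : col w₁ = (a, b))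
    (hw₂ : col w₂ = (b, a)) (hs : s ∉ IwasawaAlgebra.augIdealP 2) (hab : a + b = s * G)
    (fd : (X' ⧸ LinearMap.range (cX - 1)) →ₗ[IwasawaAlgebra 2] D.X)
    (hfd : Finite (D.X ⧸ LinearMap.range fd))
    (fy : (Y' ⧸ LinearMap.range (cY - 1)) →ₗ[IwasawaAlgebra 2] Yd.X)
    (hfy : Finite (LinearMap.ker fy)) : D.mu = 0 := by
  let 𝔭 : PrimeSpectrum (IwasawaAlgebra 2) :=
    ⟨IwasawaAlgebra.augIdealP 2, IwasawaAlgebra.isPrime_augIdealP_holds 2⟩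
  haveI := hfd
  haveI := hfy
  -- fine side: `ℓ(Y'_Δ) ≤ ℓ(ker fy) + ℓ(Yd) = 0`
  have hYd : lengthAt (IwasawaAlgebra 2) Yd.X 𝔭 = 0 :=
    lengthAt_fineSelmerDual_eq_zero_of_finite_twoTorsion W hγ Yd hA
  have hker : lengthAt (IwasawaAlgebra 2) (LinearMap.ker fy) 𝔭 = 0 :=
    lengthAt_augIdealP_eq_zero_of_finite 2 _ 𝔭 rfl
  have hY : lengthAt (IwasawaAlgebra 2) (Y' ⧸ LinearMap.range (cY - 1)) 𝔭 = 0 := by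
    have h := lengthAt_le_ker_add fy 𝔭
    rw [hker, hYd, zero_add] at h
    exact le_antisymm h bot_le
  -- even branch: `a + b = s·G ∉ (2)`
  have habp : a + b ∉ IwasawaAlgebra.augIdealP 2 :=
    hab ▸ fun h => ((IwasawaAlgebra.isPrime_augIdealP_holds 2).mem_or_mem h).elim hs
      (not_mem_augIdealP_of_red_ne_zero hred)
  have hXΔ := lengthAt_augIdealP_eq_zero_of_roadB2 2 toX π hX hπ cP cX cY hcX hcY col hcol hccol hfin
    h₁ h₂ hw₁ hw₂ habp 𝔭 rfl hY
  -- descent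
  have hc : lengthAt (IwasawaAlgebra 2) (D.X ⧸ LinearMap.range fd) 𝔭 = 0 :=
    lengthAt_augIdealP_eq_zero_of_finite 2 _ 𝔭 rfl
  have hX0 : lengthAt (IwasawaAlgebra 2) D.X 𝔭 = 0 :=
    le_antisymm ((lengthAt_le_of_lengthAt_coker_eq_zero fd 𝔭 hc).trans hXΔ.le) bot_le
  change muInvariant 2 D.X = 0
  rw [muInvariant_eq_toNat_lengthAt 2 D.X 𝔭 rfl, hX0]
  rfl

end AtTwo

/-! ## §3 The crux on road (b″) -/

section Crux

open CongruenceSubgroup WeierstrassCurve Literature.NumberTheory.EllipticCurves.ModularForms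
  Literature.NumberTheory.EllipticCurves.Greenberg1999
  Literature.NumberTheory.EllipticCurves.Rank1Residual
  Literature.NumberTheory.IwasawaTheory
  Summit.BirchSwinnertonDyer.Rank1Residual Summit.BirchSwinnertonDyer.Rank1Residual.X1.MuLambda
  Summit.BirchSwinnertonDyer.Rank1Residual.X5 Summit.BirchSwinnertonDyer.Rank1Residual.F1Sign2
  Summit.BirchSwinnertonDyer.BirchSwinnertonDyer.Theorems.Rank1ResidualX1Defs
  Summit.BirchSwinnertonDyer.BirchSwinnertonDyer.Theses.AlignedTransportAtTwo

/-- **Stub T of line `birth` on road (b″)**: modularity (PRINT) + Lim 2017 Thm. 3.5 at `2` (PRINT) + (K₂″)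
the displayed Kato data over `ℚ(ζ_{2^∞})` with `Δ`-action, finite Coleman cokernel, even-branch zeta value
`a + b = s·G₊` (`s ∉ (2)`), descent map with finite cokernel and fine comparison with finite kernel — for
every seed-cell curve, cyclotomic datum, newform and integral lift `G₊` of `L₂(f, α)` — + (A₂) a
`2`-power-index subfield of `ℚ(W[4])` with classical `μ = 0` for every seed ⟹ `SeedMuZeroAtTwo`. The crux's
even-branch `μ₂ = 0` binder is used; no odd branch; no construction target at `(2)`.
[cite: Kato2004Asterisque, §12.1, Thm. 12.6, Thm. 16.6, Prop. 17.11, §17.13 (pp. 219–280)]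
[cite: Lim2017FineSelmer, §3 Thm. 3.5 and Lemma 3.2] [cite: CoatesSujatha2005, statement (A) (§3)] -/
theorem seedMuZeroAtTwo_of_fineRoadCoinv (hmod : nonempty_modularParametrizationData)
    (hLim : Lim2017.thm35_at_two_fineSelmerDual_moduleFinite_of_classicalMuVanishes_of_le_divisionField_four)
    (hK2 : ∀ (W : WeierstrassCurve ℚ) [W.IsElliptic] [W.IsGloballyMinimal], IsOrdinaryAt W 2 →
      (∀ x : ℚ, ¬ HasRationalTwoTorsionX W x) →
      ∀ (κ : ZpExtension ℚ 2) (γ : Field.absoluteGaloisGroup ℚ), κ.IsCyclotomic →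
      κ.IsTopGenerator γ → IsCyclotomicVariable 2 γ →
      ∀ ⦃N : ℕ⦄ [NeZero N] (f : CuspForm (Gamma0 N) 2), IsNewformOf W f →
      ∀ Gp : IwasawaAlgebra 2, iwasawaToPowerSeries 2 Gp = padicLFunction f (unitRoot W 2 : ℚ_[2]) →
      ∀ (D : W.SelmerDualData κ γ) (Yd : W.FineSelmerDualData κ γ),
        ∃ (P X' Y' : Type) (_ : AddCommGroup P) (_ : _root_.Module (IwasawaAlgebra 2) P)
          (_ : AddCommGroup X') (_ : _root_.Module (IwasawaAlgebra 2) X')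
          (_ : AddCommGroup Y') (_ : _root_.Module (IwasawaAlgebra 2) Y')
          (toX : P →ₗ[IwasawaAlgebra 2] X') (π : X' →ₗ[IwasawaAlgebra 2] Y')
          (cP : P →ₗ[IwasawaAlgebra 2] P) (cX : X' →ₗ[IwasawaAlgebra 2] X')
          (cY : Y' →ₗ[IwasawaAlgebra 2] Y')
          (col : P →ₗ[IwasawaAlgebra 2] IwasawaAlgebra 2 × IwasawaAlgebra 2) (w₁ w₂ : P)
          (a b s : IwasawaAlgebra 2) (fd : (X' ⧸ LinearMap.range (cX - 1)) →ₗ[IwasawaAlgebra 2] D.X)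
          (fy : (Y' ⧸ LinearMap.range (cY - 1)) →ₗ[IwasawaAlgebra 2] Yd.X),
          Function.Exact toX π ∧ Function.Surjective π ∧ toX ∘ₗ cP = cX ∘ₗ toX ∧ π ∘ₗ cX = cY ∘ₗ π ∧
          Function.Injective col ∧
          col ∘ₗ cP = (LinearEquiv.prodComm (IwasawaAlgebra 2) (IwasawaAlgebra 2) (IwasawaAlgebra 2) :
            IwasawaAlgebra 2 × IwasawaAlgebra 2 →ₗ[IwasawaAlgebra 2]
              IwasawaAlgebra 2 × IwasawaAlgebra 2) ∘ₗ col ∧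
          Finite ((IwasawaAlgebra 2 × IwasawaAlgebra 2) ⧸ LinearMap.range col) ∧
          toX w₁ = 0 ∧ toX w₂ = 0 ∧ col w₁ = (a, b) ∧ col w₂ = (b, a) ∧
          s ∉ IwasawaAlgebra.augIdealP 2 ∧ a + b = s * Gp ∧
          Finite (D.X ⧸ LinearMap.range fd) ∧ Finite (LinearMap.ker fy))
    (hA2 : ∀ (W : WeierstrassCurve ℚ) [W.IsElliptic] [W.IsGloballyMinimal], ¬ W.HasCM →
      IsOrdinaryAt W 2 → (∀ x : ℚ, ¬ HasRationalTwoTorsionX W x) → ¬ IsSquare W.Δ →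
      W.analyticRank = 0 → BSDp W 2 →
      ∃ L : IntermediateField ℚ (AlgebraicClosure ℚ), L ≤ W.divisionField 4 ∧
        (∃ k : ℕ, Module.finrank ℚ (W.divisionField 4) = 2 ^ k * Module.finrank ℚ L) ∧
        ∀ κL : ZpExtension L 2, κL.IsCyclotomic → ClassicalMuVanishes κL) :
    ∀ (W : WeierstrassCurve ℚ) [W.IsElliptic] [W.IsGloballyMinimal], ¬ W.HasCM →
      IsOrdinaryAt W 2 → (∀ x : ℚ, ¬ HasRationalTwoTorsionX W x) → ¬ IsSquare W.Δ →
      W.analyticRank = 0 →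
      (∀ ⦃N : ℕ⦄ [NeZero N] (f : CuspForm (Gamma0 N) 2), IsNewformOf W f →
        ∀ G : IwasawaAlgebra 2, IsEvenBranchLiftAtTwo W f G → red G ≠ 0) →
      BSDp W 2 →
      ∀ (κ : ZpExtension ℚ 2) (γ : Field.absoluteGaloisGroup ℚ), κ.IsCyclotomic →
        κ.IsTopGenerator γ → IsCyclotomicVariable 2 γ →
        ∀ D : W.SelmerDualData κ γ, D.IsTorsion → D.mu = 0 := by
  intro W _ _ hcm hord ht hsq hr hμan hbsd κ γ hκ hγ hγ' D _
  have hirr : Irr W 2 := AlignedTransportAtTwoSeed.irr_two_of_forall_not_hasRationalTwoTorsionX W ht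
  haveI : NeZero (W.conductorNorm ℤ) := ⟨(W.conductorNorm_pos_holds).ne'⟩
  obtain ⟨Dm⟩ := hmod W
  obtain ⟨Gp, hGp⟩ := exists_iwasawaToPowerSeries_eq_padicLFunction_two hord Dm.isNewformOf hirr
  have hred : red Gp ≠ 0 := hμan Dm.f Dm.isNewformOf Gp (Or.inl ⟨hord, hGp⟩)
  let Yd : W.FineSelmerDualData κ γ := W.fineSelmerDualData κ hγ
  obtain ⟨P, X', Y', _, _, _, _, _, _, toX, π, cP, cX, cY, col, w₁, w₂, a, b, s, fd, fy, hX, hπ, hcX, hcY,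
    hcol, hccol, hfin, h₁, h₂, hw₁, hw₂, hs, hab, hfd, hfy⟩ :=
    hK2 W hord ht κ γ hκ hγ hγ' Dm.f Dm.isNewformOf Gp hGp D Yd
  obtain ⟨L, hL, hidx, hμL⟩ := hA2 W hcm hord ht hsq hr hbsd
  have hA := finite_fineSelmer_twoTorsion_of_classicalMu W hLim L hL hidx hμL κ hκ
  exact selmerDual_mu_eq_zero_of_roadB2_two W hγ D Yd hA hred toX π hX hπ cP cX cY hcX hcY col hcol
    hccol hfin h₁ h₂ hw₁ hw₂ hs hab fd hfd fy hfy

/-- **C2 BY NAME on road (b″).** PRINT {Kato 17.4 (1)(2) at `2`, Greenberg 4.1, period unit, modularity,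
GZK, Lim 2017 Thm. 3.5 at `2`} + (K₂″) displayed Kato data over `ℚ(i)` with the `Δ`-descent maps + (A₂)
classical `μ = 0` of the seeds' cubic fields ⟹ `MainConjectureOfRankZeroBSDAtTwo`. CONDITIONAL: the
item stays open; (A₂) is Iwasawa's conjecture for `S₃`-cubics. [cite: Kato2004Asterisque, Thm. 17.4 (p. 273) and §17.13 (pp. 279–280)]
[cite: Lim2017FineSelmer, §3 Thm. 3.5 and Lemma 3.2] [cite: GreenbergLNM1716, Thm. 4.1 (p. 102) and Conj. 1.11 (p. 58)] -/
theorem mainConjectureOfRankZeroBSDAtTwo_of_fineRoadCoinv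
    (h17 : ∀ (V : WeierstrassCurve ℚ) [V.IsElliptic] [V.IsGloballyMinimal] [NeZero (V.conductorNorm ℤ)]
      (f : CuspForm (Gamma0 (V.conductorNorm ℤ)) 2), kato_divisibility_allPrimes V 2 (f := f))
    (hGr : Greenberg1999.thm41_charValue_rankZero_anyPrime)
    (hper : realPeriodRat_eq_unit_mul_plusPeriod_two) (hmod : nonempty_modularParametrizationData)
    (hGZK : rank_eq_analyticRank_of_analyticRank_le_one)
    (hLim : Lim2017.thm35_at_two_fineSelmerDual_moduleFinite_of_classicalMuVanishes_of_le_divisionField_four)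
    (hK2 : ∀ (W : WeierstrassCurve ℚ) [W.IsElliptic] [W.IsGloballyMinimal], IsOrdinaryAt W 2 →
      (∀ x : ℚ, ¬ HasRationalTwoTorsionX W x) →
      ∀ (κ : ZpExtension ℚ 2) (γ : Field.absoluteGaloisGroup ℚ), κ.IsCyclotomic →
      κ.IsTopGenerator γ → IsCyclotomicVariable 2 γ →
      ∀ ⦃N : ℕ⦄ [NeZero N] (f : CuspForm (Gamma0 N) 2), IsNewformOf W f →
      ∀ Gp : IwasawaAlgebra 2, iwasawaToPowerSeries 2 Gp = padicLFunction f (unitRoot W 2 : ℚ_[2]) →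
      ∀ (D : W.SelmerDualData κ γ) (Yd : W.FineSelmerDualData κ γ),
        ∃ (P X' Y' : Type) (_ : AddCommGroup P) (_ : _root_.Module (IwasawaAlgebra 2) P)
          (_ : AddCommGroup X') (_ : _root_.Module (IwasawaAlgebra 2) X')
          (_ : AddCommGroup Y') (_ : _root_.Module (IwasawaAlgebra 2) Y')
          (toX : P →ₗ[IwasawaAlgebra 2] X') (π : X' →ₗ[IwasawaAlgebra 2] Y')
          (cP : P →ₗ[IwasawaAlgebra 2] P) (cX : X' →ₗ[IwasawaAlgebra 2] X')
          (cY : Y' →ₗ[IwasawaAlgebra 2] Y')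
          (col : P →ₗ[IwasawaAlgebra 2] IwasawaAlgebra 2 × IwasawaAlgebra 2) (w₁ w₂ : P)
          (a b s : IwasawaAlgebra 2) (fd : (X' ⧸ LinearMap.range (cX - 1)) →ₗ[IwasawaAlgebra 2] D.X)
          (fy : (Y' ⧸ LinearMap.range (cY - 1)) →ₗ[IwasawaAlgebra 2] Yd.X),
          Function.Exact toX π ∧ Function.Surjective π ∧ toX ∘ₗ cP = cX ∘ₗ toX ∧ π ∘ₗ cX = cY ∘ₗ π ∧
          Function.Injective col ∧
          col ∘ₗ cP = (LinearEquiv.prodComm (IwasawaAlgebra 2) (IwasawaAlgebra 2) (IwasawaAlgebra 2) :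
            IwasawaAlgebra 2 × IwasawaAlgebra 2 →ₗ[IwasawaAlgebra 2]
              IwasawaAlgebra 2 × IwasawaAlgebra 2) ∘ₗ col ∧
          Finite ((IwasawaAlgebra 2 × IwasawaAlgebra 2) ⧸ LinearMap.range col) ∧
          toX w₁ = 0 ∧ toX w₂ = 0 ∧ col w₁ = (a, b) ∧ col w₂ = (b, a) ∧
          s ∉ IwasawaAlgebra.augIdealP 2 ∧ a + b = s * Gp ∧
          Finite (D.X ⧸ LinearMap.range fd) ∧ Finite (LinearMap.ker fy))
    (hA2 : ∀ (W : WeierstrassCurve ℚ) [W.IsElliptic] [W.IsGloballyMinimal], ¬ W.HasCM →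
      IsOrdinaryAt W 2 → (∀ x : ℚ, ¬ HasRationalTwoTorsionX W x) → ¬ IsSquare W.Δ →
      W.analyticRank = 0 → BSDp W 2 →
      ∃ L : IntermediateField ℚ (AlgebraicClosure ℚ), L ≤ W.divisionField 4 ∧
        (∃ k : ℕ, Module.finrank ℚ (W.divisionField 4) = 2 ^ k * Module.finrank ℚ L) ∧
        ∀ κL : ZpExtension L 2, κL.IsCyclotomic → ClassicalMuVanishes κL) :
    MainConjectureOfRankZeroBSDAtTwo :=
  AlignedTransportAtTwoSeed.mainConjectureOfRankZeroBSDAtTwo_of_seedMuZero h17 hGr hper hmod hGZK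
    (seedMuZeroAtTwo_of_fineRoadCoinv hmod hLim hK2 hA2)

end Crux

end Summit.BirchSwinnertonDyer.BirchSwinnertonDyer.Theorems.AlignedTransportAtTwoFineRoad

end
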